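import Literature.AlgebraicGeometry.Resolution.BlowupRegularPairCharts
import Literature.AlgebraicGeometry.Resolution.BlowupDisjointCentreSplitting
import Literature.AlgebraicGeometry.Resolution.BlowupsProduct
import Literature.AlgebraicGeometry.Resolution.BlowupsLocal
import Summits.ResolutionOfSingularities.ResolutionOfSingularities.Theorems.FrobeniusLadderFInjectiveMacaulayficationIsoLocusTransport
import Summits.ResolutionOfSingularities.ResolutionOfSingularities.Theorems.FrobeniusLadderFInjectiveMacaulayficationSliceableCentre
import HarnessLib

/-!
# BED Ω, GLOBAL PATCH (g-b), F4 (c) GLUE ENGINE: the blowing up along a centre that is LOCALLY `γ·(u, v)` — an invertible factor times a regular pair — is covered, over that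
# affine open, by two affine charts with section rings `A[X]/(uX − v)` and `A[X]/(vX − u)` (`A = Γ(X̃, W)`), and its stalks there are localizations of these rings; where the
# centre is locally principal (`(γ)`, `γ` regular) the blowing up is a local isomorphism
# (crux `FInjectiveMacaulayfication` stmt-ResolutionOfSingularities-15315, chain w45a; res-L1-w45a-plan-1 BOOKED 2026-08-29T08:08:13Z «F4(c) remaining (g14): the identification GLUE
# S′|U_c ≅ the actual pencil CI chart rings (0BIQ + chart formula)»; `g13/GLOBAL-PATCH-PLAN.md` v2; seat res-L1-w45a-stub-3 g14)

[OURS · L1 W4.5a] Support file (`--supports stmt-ResolutionOfSingularities-15315 --as helper`); theorems only; GENERIC (any blowing up `τ : S′ → X̃` along any ideal sheaf `𝒥`, any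
affine open `W`); no named fact; NOT a statement of any manuscript; nothing of the crux is proved. AI-written (AI review is weaker than expert review).

THE POINT. The Ω₁ floor `S′ = Bl_𝒥 X̃` (✓ `OmegaOneFloorFactorsB9.omega1_floor_fac_classModel`) has, on every toric chart `W = U_c ∩ X̃` of the class model, `𝒥(W) = (λ_c, g_c) = y^G·(y^{M₁}, χ_c)`:
an invertible monomial factor `γ = y^G` times a pair `(u, v) = (y^{M₁}, χ_c)` which is a regular sequence in `Γ(X̃, W) ≅ k[y]/(θ_c)` (or `u` is a unit). This file turns that LOCAL
description into the scheme-level facts the census letter needs, once and for all: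
* §1 algebra: `cmCl_localization_of_ringEquiv` (CM clause at all primes along a ring isomorphism), `exists_pencilQuot_ringEquiv_of_ringEquiv`
  (`A[X]/(uX − v) ≅ B[X]/(e u·X − e v)` along `e : A ≅ B`), `regularPair_of_ringEquiv` (transport of «`u` regular, `v` regular mod `u`»).
* §2 ★ `isBlowup_restrict_pair` — if `𝒥(W) = (γu, γv)` with `γ` a non-zero-divisor of `A = Γ(X̃, W)`, then `τ|_W : τ⁻¹W → W` is a blowing up of the affine scheme `W` ALONG THE IDEAL SHEAF
  OF `(u, v)` (chart formula ✓ `ideal_comap_of_le`, factorisation `𝒥|_W = (γ)~·(u, v)~` on the affine scheme `W`, and ✓ `IsBlowup.of_mul_isEffectiveCartier_left`, Stacks 080A).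
* §3 ★★ `exists_chart_ringEquiv_of_pair` — for `(u, v)` AND `(v, u)` regular pairs of `A`: every point of `τ⁻¹W` lies in an affine open `V ⊆ τ⁻¹W` with
  `Γ(τ⁻¹W, V) ≅ A[X]/(uX − v)` or `≅ A[X]/(vX − u)` (Stacks 0804 + 0BIQ: ✓ `IsBlowup.exists_ringEquiv_blowupChart_pair`, ✓ `blowupChart_sup_blowupChart_pair`;
  `appLE_eq_restrict_appLE` records how `τ^*` reads through the restriction), and ★★ `cmCl_stalk_of_pair` — hence `CMCl 𝒪_{S′,s}` for every `s` over `W` as soon as every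
  localization of the two pencil rings satisfies the CM clause (`cmCl_stalk_of_affineOpen_ringEquiv`: stalks of an affine open are localizations of its section ring).
* §4 ★ `isIso_restrict_of_principal`, `cmCl_stalk_of_principal`, `fullCl_stalk_of_principal` — if `𝒥(W) = (γ)` with `γ` regular then `τ|_W` is an isomorphism, so the clauses of
  `X̃` at `τ s` pass to `S′` at `s`.
[cite: StacksProject, Tag 0804, Tag 0BIQ, Tag 080A, Tag 02OS; GortzWedhorn2020, Prop. 13.91 and (13.19)]
-/

set_option linter.dupNamespace false

noncomputable section

open AlgebraicGeometry CategoryTheory CategoryTheory.Limits Literature.AlgebraicGeometry.Resolution TopologicalSpace Polynomial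

namespace Summit.ResolutionOfSingularities.ResolutionOfSingularities.Theorems.FInjectiveMacaulayfication.PencilBlowupLocalCharts

open Summit.ResolutionOfSingularities.ResolutionOfSingularities.Theorems.FInjectiveMacaulayfication
open SliceableCentre

/-! ## §1 Algebra: transport along ring isomorphisms -/

/-- The CM clause at EVERY localization transports along a ring isomorphism `e : A ≃+* B`. [folklore transport] -/
theorem cmCl_localization_of_ringEquiv {A B : Type} [CommRing A] [CommRing B] (e : A ≃+* B)
    (h : ∀ (Q : Ideal B) [Q.IsPrime], CMCl (Localization.AtPrime Q)) (P : Ideal A) [P.IsPrime] : CMCl (Localization.AtPrime P) := by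
  set Q : Ideal B := P.comap e.symm.toRingHom with hQ
  haveI : Q.IsPrime := Ideal.comap_isPrime e.symm.toRingHom P
  have eP : Localization.AtPrime P ≃+* Localization.AtPrime Q := by
    refine IsLocalization.ringEquivOfRingEquiv (M := P.primeCompl) (T := Q.primeCompl) (Localization.AtPrime P) (Localization.AtPrime Q) e ?_
    ext y
    simp only [Submonoid.mem_map]
    constructor
    · rintro ⟨b, hb, rfl⟩
      intro hy
      exact hb (by simpa [hQ, Ideal.mem_comap] using hy)
    · intro hy
      refine ⟨e.symm y, fun h' => hy ?_, e.apply_symm_apply y⟩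
      simpa [hQ, Ideal.mem_comap] using h'
  exact FiLocusOpenOfAffine.cmClause_of_ringEquiv eP.symm (h Q)

/-- `A[X]/(uX − v) ≅ B[X]/(e u·X − e v)` along a ring isomorphism `e : A ≅ B`, with `ā ↦ e a‾` and `X̄ ↦ X̄`. [folklore transport] -/
theorem exists_pencilQuot_ringEquiv_of_ringEquiv {A B : Type} [CommRing A] [CommRing B] (e : A ≃+* B) (u v : A) :
    ∃ ε : (A[X] ⧸ Ideal.span {C u * X - C v}) ≃+* (B[X] ⧸ Ideal.span {C (e u) * X - C (e v)}),
      (∀ a, ε (Ideal.Quotient.mk _ (C a)) = Ideal.Quotient.mk _ (C (e a))) ∧ ε (Ideal.Quotient.mk _ X) = Ideal.Quotient.mk _ X := by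
  have hIJ : Ideal.span {C (e u) * X - C (e v)} = (Ideal.span {C u * X - C v}).map ((Polynomial.mapEquiv e : A[X] ≃+* B[X]) : A[X] →+* B[X]) := by
    rw [Ideal.map_span, Set.image_singleton]
    congr 2
    simp [Polynomial.map_X]
  refine ⟨Ideal.quotientEquiv _ _ (Polynomial.mapEquiv e : A[X] ≃+* B[X]) hIJ, fun a => ?_, ?_⟩
  · rw [Ideal.quotientEquiv_mk]
    simp
  · rw [Ideal.quotientEquiv_mk]
    simp [Polynomial.map_X]

/-- «`u` a non-zero-divisor and `v` regular modulo `u`» transports along a ring isomorphism. [folklore transport] -/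
theorem regularPair_of_ringEquiv {A B : Type} [CommRing A] [CommRing B] (e : A ≃+* B) {u v : A} (hu : u ∈ nonZeroDivisors A)
    (huv : ∀ r : A, u ∣ r * v → u ∣ r) : e u ∈ nonZeroDivisors B ∧ ∀ r : B, e u ∣ r * e v → e u ∣ r := by
  refine ⟨?_, fun r hr => ?_⟩
  · exact mem_nonZeroDivisors_of_injective (f := e.symm.toRingHom) e.symm.injective (by simpa using hu)
  · have h1 : u ∣ e.symm r * v := by
      have := map_dvd e.symm.toRingHom hr
      simpa using this
    simpa using map_dvd e.toRingHom (huv _ h1)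

/-- `(γu, γv) = (γ)·(u, v)`. [bookkeeping] -/
theorem span_pair_mul_left {A : Type} [CommRing A] (γ u v : A) : Ideal.span {γ * u, γ * v} = Ideal.span {γ} * Ideal.span {u, v} := by
  rw [Ideal.span_insert, Ideal.span_insert, Ideal.mul_sup, Ideal.span_singleton_mul_span_singleton, Ideal.span_singleton_mul_span_singleton]

/-! ## §2 Restricting over an affine open on which `𝒥 = (γ)·(u, v)` -/

section Local

variable {Xt S' : Scheme.{0}} {τ : S' ⟶ Xt} {𝒥 : Xt.IdealSheafData}

/-- Stacks 080A read backwards: a blowing up along `H·J` with `H` an effective Cartier divisor is a blowing up along `J`. [cite: StacksProject, Tag 080A] -/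
-- adapted from Literature `ResolutionDominatedByBlowup.IsBlowup.of_mul_isEffectiveCartier_left` (same five lines; that module's imports are heavy)
theorem isBlowup_of_mul_isEffectiveCartier_left {X X' : Scheme.{0}} {π : X' ⟶ X} {H J : X.IdealSheafData} (hπ : IsBlowup π (H * J))
    (hH : IsEffectiveCartier H) : IsBlowup π J := by
  obtain ⟨X₁, τ₁, τ₂, hτ₁, hτ₂, hcomp⟩ := hπ.exists_comp_eq_of_mul'
  haveI : IsIso τ₂ := hτ₂.isIso (hH.comap_of_isBlowup hτ₁)
  rw [← hcomp]
  exact hτ₁.iso_comp (asIso τ₂)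

/-- The restriction `Γ(X̃, W) → Γ(W, ⊤)` to an affine open, viewed as the open subscheme's global sections, is a ring ISOMORPHISM (Mathlib: `IsIso (W.ι.appLE W ⊤ _)`). [plumbing] -/
theorem exists_resTop (W : Xt.affineOpens) :
    ∃ e : Γ(Xt, W) ≃+* Γ((W : Xt.Opens), ⊤), ∀ x, e x = ((W : Xt.Opens).ι.appLE W ⊤ (W : Xt.Opens).ι_preimage_self.ge).hom x :=
  ⟨(asIso ((W : Xt.Opens).ι.appLE W ⊤ (W : Xt.Opens).ι_preimage_self.ge)).commRingCatIsoToRingEquiv, fun _ => rfl⟩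

/-- Chart formula for the restricted centre: `(𝒥|_W)(⊤) = 𝒥(W)·Γ(W, ⊤)`. [cite: GortzWedhorn2020, (13.19)] -/
theorem ideal_comap_ι_top (W : Xt.affineOpens) :
    (𝒥.comap (W : Xt.Opens).ι).ideal ⟨⊤, isAffineOpen_top _⟩ = (𝒥.ideal W).map ((W : Xt.Opens).ι.appLE W ⊤ (W : Xt.Opens).ι_preimage_self.ge).hom :=
  ideal_comap_of_le (W : Xt.Opens).ι 𝒥 W ⟨⊤, isAffineOpen_top _⟩ _

/-- ★ **RESTRICTION OVER A `γ·(u, v)`-OPEN IS A BLOWING UP ALONG `(u, v)~`.** If `𝒥(W) = (γu, γv)` with `γ` a non-zero-divisor of `Γ(X̃, W)`, then `τ|_W : τ⁻¹W → W` is a blowing up of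
the affine scheme `W` along the ideal sheaf of `(u, v)` (transported to `Γ(W, ⊤)` along the restriction isomorphism `e`). [OURS · F4 (c) glue; cite: StacksProject, Tag 080A] -/
theorem isBlowup_restrict_pair (hτ : IsBlowup τ 𝒥) (W : Xt.affineOpens) (γ u v : Γ(Xt, W)) (h𝒥 : 𝒥.ideal W = Ideal.span {γ * u, γ * v})
    (hγ : γ ∈ nonZeroDivisors Γ(Xt, W)) (e : Γ(Xt, W) ≃+* Γ((W : Xt.Opens), ⊤))
    (he : ∀ x, e x = ((W : Xt.Opens).ι.appLE W ⊤ (W : Xt.Opens).ι_preimage_self.ge).hom x) :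
    IsBlowup (τ ∣_ (W : Xt.Opens)) (Scheme.IdealSheafData.ofIdealTop (Ideal.span {e u, e v})) := by
  haveI : IsAffine (W : Xt.Opens) := W.2
  have h1 : IsBlowup (τ ∣_ (W : Xt.Opens)) (𝒥.comap (W : Xt.Opens).ι) := hτ.restrict _
  have hfac : 𝒥.comap (W : Xt.Opens).ι =
      Scheme.IdealSheafData.ofIdealTop (Ideal.span {e γ}) * Scheme.IdealSheafData.ofIdealTop (Ideal.span {e u, e v}) := by
    apply Scheme.IdealSheafData.ext_of_isAffine
    rw [Scheme.IdealSheafData.ideal_mul, Pi.mul_apply, ideal_ofIdealTop_top, ideal_ofIdealTop_top, ideal_comap_ι_top, h𝒥, Ideal.map_span,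
      Set.image_pair, map_mul, map_mul, ← he, ← he, ← he, span_pair_mul_left]
  have hH : IsEffectiveCartier (Scheme.IdealSheafData.ofIdealTop (Ideal.span {e γ}) : Scheme.IdealSheafData (W : Xt.Opens)) := by
    intro x
    refine ⟨⟨⊤, isAffineOpen_top _⟩, trivial, e γ, ?_, ideal_ofIdealTop_top _⟩
    exact mem_nonZeroDivisors_of_injective (f := e.symm.toRingHom) e.symm.injective (by simpa using hγ)
  rw [hfac] at h1
  exact isBlowup_of_mul_isEffectiveCartier_left h1 hH

/-! ## §3 The two pencil charts over `W` and the stalks of `S′` there -/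

/-- The structure map of `τ` into a chart of `τ⁻¹W`, read through the restriction `τ|_W` and the isomorphism `Γ(X̃, W) ≅ Γ(W, ⊤)`. [plumbing] -/
theorem appLE_eq_restrict_appLE (W : Xt.affineOpens) (e : Γ(Xt, W) ≃+* Γ((W : Xt.Opens), ⊤))
    (he : ∀ x, e x = ((W : Xt.Opens).ι.appLE W ⊤ (W : Xt.Opens).ι_preimage_self.ge).hom x)
    (Vc : (τ ⁻¹ᵁ (W : Xt.Opens)).toScheme.Opens) (hle : (τ ⁻¹ᵁ (W : Xt.Opens)).ι ''ᵁ Vc ≤ τ ⁻¹ᵁ (W : Xt.Opens))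
    (hle' : Vc ≤ (τ ∣_ (W : Xt.Opens)) ⁻¹ᵁ ((⟨⊤, isAffineOpen_top _⟩ : (W : Xt.Opens).toScheme.affineOpens) : (W : Xt.Opens).toScheme.Opens)) (a : Γ(Xt, W)) :
    (τ.appLE W ((τ ⁻¹ᵁ (W : Xt.Opens)).ι ''ᵁ Vc) hle).hom a =
      ((τ ∣_ (W : Xt.Opens)).appLE ((⟨⊤, isAffineOpen_top _⟩ : (W : Xt.Opens).toScheme.affineOpens) : (W : Xt.Opens).toScheme.Opens) Vc hle').hom (e a) := by
  rw [he, morphismRestrict_appLE, Scheme.Opens.ι_appLE, ← RingHom.comp_apply, ← CommRingCat.hom_comp]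
  erw [Scheme.Hom.map_appLE]
  rfl

/-- ★★ **THE TWO PENCIL CHARTS.** Let `τ : S′ → X̃` be a blowing up along `𝒥`, `W ⊆ X̃` an affine open with `𝒥(W) = (γu, γv)`, `γ, u, v ∈ A = Γ(X̃, W)`, `γ` a non-zero-divisor and
`(u, v)`, `(v, u)` regular pairs. Then every point of `τ⁻¹W` lies in an affine open `V ⊆ τ⁻¹W` whose section ring is `A[X]/(uX − v)` or `A[X]/(vX − u)` (the two charts
`{uW = v}`, `{vU = u}` of `Bl_{(u,v)}`). [OURS · F4 (c) glue; cite: StacksProject, Tag 0804 and Tag 0BIQ; Fulton1998, proof of Lemma 2.4 (p. 37)] -/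
theorem exists_chart_ringEquiv_of_pair (hτ : IsBlowup τ 𝒥) (W : Xt.affineOpens) (γ u v : Γ(Xt, W)) (h𝒥 : 𝒥.ideal W = Ideal.span {γ * u, γ * v})
    (hγ : γ ∈ nonZeroDivisors Γ(Xt, W)) (hu : u ∈ nonZeroDivisors Γ(Xt, W)) (huv : ∀ r : Γ(Xt, W), u ∣ r * v → u ∣ r)
    (hv : v ∈ nonZeroDivisors Γ(Xt, W)) (hvu : ∀ r : Γ(Xt, W), v ∣ r * u → v ∣ r) (s' : ↥(τ ⁻¹ᵁ (W : Xt.Opens))) :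
    ∃ (V : (τ ⁻¹ᵁ (W : Xt.Opens)).toScheme.Opens) (_ : IsAffineOpen V), s' ∈ V ∧
      (Nonempty (Γ((τ ⁻¹ᵁ (W : Xt.Opens)).toScheme, V) ≃+* (Γ(Xt, W)[X] ⧸ Ideal.span {C u * X - C v})) ∨
       Nonempty (Γ((τ ⁻¹ᵁ (W : Xt.Opens)).toScheme, V) ≃+* (Γ(Xt, W)[X] ⧸ Ideal.span {C v * X - C u}))) := by
  haveI : IsAffine (W : Xt.Opens) := W.2
  obtain ⟨e, he⟩ := exists_resTop W
  have hB := isBlowup_restrict_pair hτ W γ u v h𝒥 hγ e he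
  have hJ'T : (Scheme.IdealSheafData.ofIdealTop (Ideal.span {e u, e v}) : (W : Xt.Opens).toScheme.IdealSheafData).ideal ⟨⊤, isAffineOpen_top _⟩ =
      Ideal.span {e u, e v} := ideal_ofIdealTop_top _
  have hJ'T' : (Scheme.IdealSheafData.ofIdealTop (Ideal.span {e u, e v}) : (W : Xt.Opens).toScheme.IdealSheafData).ideal ⟨⊤, isAffineOpen_top _⟩ =
      Ideal.span {e v, e u} := by rw [hJ'T, Set.pair_comm]
  obtain ⟨hu', huv'⟩ := regularPair_of_ringEquiv e hu huv
  obtain ⟨hv', hvu'⟩ := regularPair_of_ringEquiv e hv hvu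
  have huJ : e u ∈ (Scheme.IdealSheafData.ofIdealTop (Ideal.span {e u, e v}) : (W : Xt.Opens).toScheme.IdealSheafData).ideal ⟨⊤, isAffineOpen_top _⟩ := by
    rw [hJ'T]; exact Ideal.subset_span (by simp)
  have hvJ : e v ∈ (Scheme.IdealSheafData.ofIdealTop (Ideal.span {e u, e v}) : (W : Xt.Opens).toScheme.IdealSheafData).ideal ⟨⊤, isAffineOpen_top _⟩ := by
    rw [hJ'T]; exact Ideal.subset_span (by simp)
  -- the two charts cover `τ⁻¹ W`
  have hcov := hB.blowupChart_sup_blowupChart_pair ⟨⊤, isAffineOpen_top _⟩ hJ'T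
  have hs'mem : s' ∈
      blowupChart (τ ∣_ (W : Xt.Opens)) (Scheme.IdealSheafData.ofIdealTop (Ideal.span {e u, e v})) ⟨⊤, isAffineOpen_top _⟩ (e u) ⊔
        blowupChart (τ ∣_ (W : Xt.Opens)) (Scheme.IdealSheafData.ofIdealTop (Ideal.span {e u, e v})) ⟨⊤, isAffineOpen_top _⟩ (e v) := by
    rw [hcov]; exact trivial
  -- polynomial-quotient transports back to `A = Γ(X̃, W)`
  obtain ⟨εu, -, -⟩ := exists_pencilQuot_ringEquiv_of_ringEquiv e u v
  obtain ⟨εv, -, -⟩ := exists_pencilQuot_ringEquiv_of_ringEquiv e v u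
  rcases Opens.mem_sup.mp hs'mem with h | h
  · obtain ⟨ε, -⟩ := hB.exists_ringEquiv_blowupChart_pair ⟨⊤, isAffineOpen_top _⟩ hJ'T hu' huv'
    exact ⟨_, hB.isAffineOpen_blowupChart huJ, h, Or.inl ⟨ε.trans εu.symm⟩⟩
  · obtain ⟨ε, -⟩ := hB.exists_ringEquiv_blowupChart_pair ⟨⊤, isAffineOpen_top _⟩ hJ'T' hv' hvu'
    exact ⟨_, hB.isAffineOpen_blowupChart hvJ, h, Or.inr ⟨ε.trans εv.symm⟩⟩

/-- The CM clause at a point of an affine open from the CM clause at every localization of (a ring isomorphic to) its section ring. [folklore transport] -/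
theorem cmCl_stalk_of_affineOpen_ringEquiv {Y : Scheme.{0}} {V : Y.Opens} (hV : IsAffineOpen V) {B : Type} [CommRing B] (ε : Γ(Y, V) ≃+* B)
    (hB : ∀ (Q : Ideal B) [Q.IsPrime], CMCl (Localization.AtPrime Q)) (y : Y) (hy : y ∈ V) : CMCl (Y.presheaf.stalk y) := by
  letI : Algebra Γ(Y, V) (Y.presheaf.stalk y) := TopCat.Presheaf.algebra_section_stalk Y.presheaf (⟨y, hy⟩ : V)
  haveI : IsLocalization.AtPrime (Y.presheaf.stalk y) (hV.primeIdealOf ⟨y, hy⟩).asIdeal := hV.isLocalization_stalk ⟨y, hy⟩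
  exact FiLocusOpenOfAffine.cmClause_of_ringEquiv
    (IsLocalization.algEquiv (hV.primeIdealOf ⟨y, hy⟩).asIdeal.primeCompl (Localization.AtPrime (hV.primeIdealOf ⟨y, hy⟩).asIdeal) (Y.presheaf.stalk y)).toRingEquiv
    (cmCl_localization_of_ringEquiv ε hB _)

/-- ★★ **CM STALKS OVER A PENCIL OPEN.** In the setting of `exists_chart_ringEquiv_of_pair`: if every localization of `A[X]/(uX − v)` and of `A[X]/(vX − u)` (`A = Γ(X̃, W)`) satisfies the
CM clause, then so does `𝒪_{S′,s}` for every `s ∈ S′` over `W`. [OURS · F4 (c) glue; cite: StacksProject, Tag 0804 and Tag 0BIQ] -/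
theorem cmCl_stalk_of_pair (hτ : IsBlowup τ 𝒥) (W : Xt.affineOpens) (γ u v : Γ(Xt, W)) (h𝒥 : 𝒥.ideal W = Ideal.span {γ * u, γ * v})
    (hγ : γ ∈ nonZeroDivisors Γ(Xt, W)) (hu : u ∈ nonZeroDivisors Γ(Xt, W)) (huv : ∀ r : Γ(Xt, W), u ∣ r * v → u ∣ r)
    (hv : v ∈ nonZeroDivisors Γ(Xt, W)) (hvu : ∀ r : Γ(Xt, W), v ∣ r * u → v ∣ r)
    (hW : ∀ (Q : Ideal (Γ(Xt, W)[X] ⧸ Ideal.span {C u * X - C v})) [Q.IsPrime], CMCl (Localization.AtPrime Q))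
    (hU : ∀ (Q : Ideal (Γ(Xt, W)[X] ⧸ Ideal.span {C v * X - C u})) [Q.IsPrime], CMCl (Localization.AtPrime Q))
    (s : S') (hs : τ.base s ∈ (W : Xt.Opens)) : CMCl (S'.presheaf.stalk s) := by
  obtain ⟨V, hV, hsV, hiso⟩ := exists_chart_ringEquiv_of_pair hτ W γ u v h𝒥 hγ hu huv hv hvu ⟨s, hs⟩
  have key : CMCl ((τ ⁻¹ᵁ (W : Xt.Opens)).toScheme.presheaf.stalk (⟨s, hs⟩ : ↥(τ ⁻¹ᵁ (W : Xt.Opens)))) := by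
    rcases hiso with ⟨⟨ε⟩⟩ | ⟨⟨ε⟩⟩
    · exact cmCl_stalk_of_affineOpen_ringEquiv hV ε hW _ hsV
    · exact cmCl_stalk_of_affineOpen_ringEquiv hV ε hU _ hsV
  exact FiLocusOpenOfAffine.cmClause_of_ringEquiv ((τ ⁻¹ᵁ (W : Xt.Opens)).stalkIso ⟨s, hs⟩).commRingCatIsoToRingEquiv key

/-! ## §4 Where the centre is principal the blowing up is a local isomorphism -/

/-- ★ If `𝒥(W) = (γ)` with `γ` a non-zero-divisor of `Γ(X̃, W)` then `τ|_W : τ⁻¹W → W` is an ISOMORPHISM (the pulled-back centre is an effective Cartier divisor on `W`; universal property).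
[cite: StacksProject, Tag 02OS; GortzWedhorn2020, Prop. 13.91] -/
theorem isIso_restrict_of_principal (hτ : IsBlowup τ 𝒥) (W : Xt.affineOpens) (γ : Γ(Xt, W)) (h𝒥 : 𝒥.ideal W = Ideal.span {γ})
    (hγ : γ ∈ nonZeroDivisors Γ(Xt, W)) : IsIso (τ ∣_ (W : Xt.Opens)) := by
  haveI : IsAffine (W : Xt.Opens) := W.2
  obtain ⟨e, he⟩ := exists_resTop W
  refine (hτ.restrict (W : Xt.Opens)).isIso fun x => ⟨⟨⊤, isAffineOpen_top _⟩, trivial, e γ,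
    mem_nonZeroDivisors_of_injective (f := e.symm.toRingHom) e.symm.injective (by simpa using hγ), ?_⟩
  rw [ideal_comap_ι_top, h𝒥, Ideal.map_span, Set.image_singleton, ← he]

/-- ★ **CM STALKS OVER A PRINCIPAL OPEN**: if `𝒥(W) = (γ)`, `γ` regular, the CM clause passes from `𝒪_{X̃, τ s}` to `𝒪_{S′, s}` for `s` over `W`. [OURS · F4 (c) glue; cite: StacksProject, Tag 02OS] -/
theorem cmCl_stalk_of_principal (hτ : IsBlowup τ 𝒥) (W : Xt.affineOpens) (γ : Γ(Xt, W)) (h𝒥 : 𝒥.ideal W = Ideal.span {γ}) (hγ : γ ∈ nonZeroDivisors Γ(Xt, W))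
    (s : S') (hs : τ.base s ∈ (W : Xt.Opens)) (hX : CMCl (Xt.presheaf.stalk (τ.base s))) : CMCl (S'.presheaf.stalk s) := by
  haveI := isIso_restrict_of_principal hτ W γ h𝒥 hγ
  exact (IsoLocusTransport.cmClause_iff_of_isIso_morphismRestrict τ (W : Xt.Opens) s hs).mp hX

/-- `FullCl p` transports along a ring isomorphism. [folklore transport] -/
theorem fullCl_of_ringEquiv' (p : ℕ) {A B : Type} [CommRing A] [CommRing B] (e : A ≃+* B) (h : FullCl p A) : FullCl p B := by
  obtain ⟨hdom, hcl⟩ := h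
  haveI := hdom
  exact ⟨MulEquiv.isDomain A e.symm.toMulEquiv, DegreeZeroDescent.inlineClause_of_ringEquiv p e hcl⟩

/-- ★ **FULL STALKS OVER A PRINCIPAL OPEN**: if `𝒥(W) = (γ)`, `γ` regular, `FullCl p` passes from `𝒪_{X̃, τ s}` to `𝒪_{S′, s}` for `s` over `W`. [OURS · F4 (c)/F6 glue; cite: StacksProject, Tag 02OS] -/
theorem fullCl_stalk_of_principal (p : ℕ) (hτ : IsBlowup τ 𝒥) (W : Xt.affineOpens) (γ : Γ(Xt, W)) (h𝒥 : 𝒥.ideal W = Ideal.span {γ}) (hγ : γ ∈ nonZeroDivisors Γ(Xt, W))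
    (s : S') (hs : τ.base s ∈ (W : Xt.Opens)) (hX : FullCl p (Xt.presheaf.stalk (τ.base s))) : FullCl p (S'.presheaf.stalk s) := by
  haveI := isIso_restrict_of_principal hτ W γ h𝒥 hγ
  haveI := IsoLocusTransport.isIso_stalkMap_of_isIso_morphismRestrict τ (W : Xt.Opens) s hs
  exact fullCl_of_ringEquiv' p (asIso (τ.stalkMap s)).commRingCatIsoToRingEquiv hX

end Local

end Summit.ResolutionOfSingularities.ResolutionOfSingularities.Theorems.FInjectiveMacaulayfication.PencilBlowupLocalCharts

end
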